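import Literature.Geometry.Lorentzian.KerrRedShiftWeightedEstimatePoly
import HarnessLib

/-!
# The red-shift estimate between admissible graph leaves with κ-EXPLICIT constants, II: the limit
# `ε → 0` (DRSR Prop. 4.5.2 with collar width linear in `κ` and constant `∝ κ⁻¹η⁻¹`)
(namespace `Literature.Geometry.Lorentzian.Kerr`.)

Second half of the `κ`-tracking pass over `Kerr.redShift_estimate` (`KerrRedShiftEstimate.lean`): the SAME
proof (exhaustion of `{r > r₊}` by `{u₂ ≥ 2/(n + 1)}`, monotone convergence) run on
`Kerr.redShift_weighted_estimate_poly` with the explicit cut-off bound `|∂_μχ| ≤ 4C_σ/η`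
(`Kerr.abs_fderiv_collarCutoff_le`):

* `Kerr.redShift_estimate_poly` — for `|a| < M`, a bound `C_σ` of `|σ'|` (`σ = Real.smoothTransition`) and
  EVERY collar width `0 < η ≤ M²κ/4096` (`κ = Kerr.surfaceGravity M a`), the red-shift estimate of
  `Kerr.redShift_estimate` holds with the constant
  `1201 · (6 + (48000(160D + 1) + 8000)/κ) · (1 + 16C_σ/η) / c`, `D = (4640 + 80C_σ)/M`:
  polynomial (degree one) in `κ⁻¹` AND in `η⁻¹`, uniformly on the whole sub-extremal range.
The factor `η⁻¹` is genuine (the cut-off error lives on a shell of width `η/2` and the constant in front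
of the shell integral must be `≳ η⁻¹`: an infalling packet of `r`-width `≪ η` has shell time-integral
`≍ Eη/2` but energy `E` once inside the inner collar); at the natural width `η ≍ κ` the constant is `≍ κ⁻²`.

## References
* M. Dafermos, I. Rodnianski, Y. Shlapentokh-Rothman, arXiv:1402.7034, §2.3.2, Prop. 4.5.2, §13.2
  (key `DafermosRodnianskiShlapentokhrothman2014`).
* M. Dafermos, I. Rodnianski, arXiv:0811.0354, §3.3.3, Thm. 7.1 (key `DafermosRodnianski2008`).
-/

noncomputable section

open Set Filter Metric MeasureTheory
open scoped Topology ENNReal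

namespace Literature.Geometry.Lorentzian

namespace Kerr

variable {M a : ℝ} {x : E4}

set_option maxHeartbeats 400000 in
/-- **The red-shift estimate between admissible graph leaves with κ-explicit width and constant**
(Dafermos–Rodnianski–Shlapentokh-Rothman arXiv:1402.7034, Prop. 4.5.2 with the zeroth order terms removed,
in the form of the first display of §13.2). For sub-extremal `(M, a)`, `κ = Kerr.surfaceGravity M a`, a
bound `C_σ` for `|σ'|` and every collar width `0 < η ≤ M²κ/4096`: for every `C²` height `F` of slope
`‖dF‖ ≤ 1 − c` (`0 < c ≤ 1`), every `Φ` of class `C²` on the exterior solving the Kerr wave equation there,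
and every `s ≥ 0`,
`∫_{Σ̃_s ∩ {r₊ < r ≤ r₊ + η/2}} e[Φ] + ∫_0^s∫_{Σ̃_u ∩ {r₊ < r ≤ r₊ + η/2}} e[Φ]
  ≤ (C_{M,C_σ}(κ, η)/c)(∫_{Σ̃_0 ∩ {r₊ < r ≤ r₊ + η}} e[Φ] + ∫_0^s∫_{Σ̃_u ∩ {r₊ + η/2 ≤ r ≤ r₊ + η}} e[Φ])`
with `C_{M,C_σ}(κ, η) = 1201(6 + (48000(160D + 1) + 8000)/κ)(1 + 16C_σ/η)`, `D = (4640 + 80C_σ)/M`.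
Proof: verbatim `Kerr.redShift_estimate` over `Kerr.redShift_weighted_estimate_poly`.
[cite: DafermosRodnianskiShlapentokhrothman2014, Prop. 4.5.2 and §13.2] -/
theorem redShift_estimate_poly (hMa : IsSubextremal M a) {Cσ : ℝ}
    (hCσ : ∀ t, |deriv Real.smoothTransition t| ≤ Cσ) {η : ℝ} (hη : 0 < η)
    (hηle : η ≤ M ^ 2 * surfaceGravity M a / 4096) :
      ∀ (F : E3 → ℝ) (c : ℝ), ContDiff ℝ 2 F → 0 < c → c ≤ 1 →
      (∀ y, ‖fderiv ℝ F y‖ ≤ 1 - c) →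
      ∀ Φ : E4 → ℝ,
      (∀ x ∈ (exterior M a : Set E4), ContDiffAt ℝ 2 Φ x) →
      (∀ x ∈ (exterior M a : Set E4),
        KerrSchild.waveOperator
          (KerrSchild.inverseMetric (fun y ↦ 2 * scalarH M a y) (nullVector a)) Φ x = 0) →
      ∀ s : ℝ, 0 ≤ s →
        (∫⁻ y, {y : E3 | rPlus M a < radius a (E4.ofTimeSpace (s + F y) y) ∧
              radius a (E4.ofTimeSpace (s + F y) y) ≤ rPlus M a + η / 2}.indicator
            (fun y ↦ ENNReal.ofReal
              (∑ μ, fderiv ℝ Φ (E4.ofTimeSpace (s + F y) y) (E4.basisVector μ) ^ 2)) y) +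
          ∫⁻ u in Set.Ioc 0 s, ∫⁻ y,
            {y : E3 | rPlus M a < radius a (E4.ofTimeSpace (u + F y) y) ∧
              radius a (E4.ofTimeSpace (u + F y) y) ≤ rPlus M a + η / 2}.indicator
            (fun y ↦ ENNReal.ofReal
              (∑ μ, fderiv ℝ Φ (E4.ofTimeSpace (u + F y) y) (E4.basisVector μ) ^ 2)) y ≤
        ENNReal.ofReal (1201 * (6 + (48000 * (160 * ((4640 + 80 * Cσ) / M) + 1) + 8000) /
            surfaceGravity M a) * (1 + 16 * Cσ / η) / c) *
          ((∫⁻ y, {y : E3 | rPlus M a < radius a (E4.ofTimeSpace (0 + F y) y) ∧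
                radius a (E4.ofTimeSpace (0 + F y) y) ≤ rPlus M a + η}.indicator
              (fun y ↦ ENNReal.ofReal
                (∑ μ, fderiv ℝ Φ (E4.ofTimeSpace (0 + F y) y) (E4.basisVector μ) ^ 2)) y) +
            ∫⁻ u in Set.Ioc 0 s, ∫⁻ y,
              {y : E3 | rPlus M a + η / 2 ≤ radius a (E4.ofTimeSpace (u + F y) y) ∧
                radius a (E4.ofTimeSpace (u + F y) y) ≤ rPlus M a + η}.indicator
              (fun y ↦ ENNReal.ofReal
                (∑ μ, fderiv ℝ Φ (E4.ofTimeSpace (u + F y) y) (E4.basisVector μ) ^ 2)) y) := by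
  intro F c hF hc hc1 hslope Φ hΦ hsol s hs
  obtain ⟨A, C, hA, hAlow, hC0, hCle, hest⟩ := redShift_weighted_estimate_poly hMa hCσ hη hηle
  have hrp : 0 < rPlus M a := hMa.rPlus_pos
  have hκ : 0 < surfaceGravity M a := hMa.surfaceGravity_pos
  have hC0σ : 0 ≤ Cσ := (abs_nonneg _).trans (hCσ 0)
  set R₁ : ℝ := rPlus M a + η / 2 with hR₁
  set R₂ : ℝ := rPlus M a + η with hR₂
  have hR₁pos : 0 < R₁ := by positivity
  have hR12 : R₁ < R₂ := by rw [hR₁, hR₂]; linarith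
  have hrR₁ : rPlus M a < R₁ := by rw [hR₁]; linarith
  have haR : a ^ 2 ≤ R₁ ^ 2 := by
    have h1 : |a| ≤ R₁ := by
      rw [hR₁]; linarith [le_of_lt hMa, rPlus_sub_self M a, Real.sqrt_nonneg (M ^ 2 - a ^ 2)]
    have h2 := pow_le_pow_left₀ (abs_nonneg a) h1 2
    rwa [sq_abs] at h2
  -- the explicit bound `|∂_μχ| ≤ L = 4C_σ/η` (support in the shell from the qualitative lemma)
  obtain ⟨L', -, hL'⟩ := exists_abs_fderiv_collarCutoff_le (a := a) hR₁pos hR12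
  set L : ℝ := 4 * Cσ / η with hLdef
  have hL0 : 0 ≤ L := by positivity
  have hL : ∀ (x : E4) (μ : Fin 4), |fderiv ℝ (collarCutoff a R₁ R₂) x (E4.basisVector μ)| ≤ L ∧
      (fderiv ℝ (collarCutoff a R₁ R₂) x (E4.basisVector μ) ≠ 0 →
        R₁ ≤ radius a x ∧ radius a x ≤ R₂) := fun x μ ↦
    ⟨(abs_fderiv_collarCutoff_le hCσ hR₁pos hR12 haR x μ).trans_eq
      (by rw [hLdef, hR₁, hR₂, show rPlus M a + η - (rPlus M a + η / 2) = η / 2 by ring,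
        div_div_eq_mul_div]; ring), (hL' x μ).2⟩
  have hC1 : 0 < C + 1 := by linarith
  set C₆ : ℝ := (C + 1) / A * (1 + 4 * L) with hC₆
  have hC₆pos : 0 < C₆ := mul_pos (div_pos hC1 hA) (by linarith)
  -- `C₆ ≤` the explicit constant
  have hC₆le : C₆ ≤ 1201 * (6 + (48000 * (160 * ((4640 + 80 * Cσ) / M) + 1) + 8000) /
      surfaceGravity M a) * (1 + 16 * Cσ / η) := by
    have hden : 0 < 6 + (48000 * (160 * ((4640 + 80 * Cσ) / M) + 1) + 8000) / surfaceGravity M a := by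
      have : 0 ≤ (4640 + 80 * Cσ) / M := by have := hMa.pos; positivity
      positivity
    have h1 : (C + 1) / A ≤ 1201 * (6 + (48000 * (160 * ((4640 + 80 * Cσ) / M) + 1) + 8000) /
        surfaceGravity M a) := by
      rw [div_le_iff₀ hA]
      have h2 := mul_le_mul_of_nonneg_left ((div_le_iff₀ hden).1 hAlow) (by linarith : (0 : ℝ) ≤ C + 1)
      have h4 : (C + 1) * (A * (6 + (48000 * (160 * ((4640 + 80 * Cσ) / M) + 1) + 8000) /
          surfaceGravity M a)) ≤ 1201 * (A * (6 + (48000 * (160 * ((4640 + 80 * Cσ) / M) + 1) + 8000) /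
          surfaceGravity M a)) := mul_le_mul_of_nonneg_right (by linarith) (by positivity)
      linarith only [h2, h4]
    have h3 : 1 + 4 * L = 1 + 16 * Cσ / η := by rw [hLdef]; ring
    rw [hC₆, h3]
    exact mul_le_mul_of_nonneg_right h1 (by positivity)
  -- ### the equation on the surgered background; the slope of `F`
  set B := surgeryBackground M a (rPlus M a) hMa.pos.le hMa.rPlus_pos with hB
  have hsolB : ∀ x ∈ (exterior M a : Set E4),
      KerrSchild.waveOperator B.inverseMetric Φ x = 0 := by
    intro x hx
    rw [← KerrSchild.waveOperator_congr_of_eventuallyEq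
      (surgeryBackground_inverseMetric_eventuallyEq M a hMa.pos.le hMa.rPlus_pos ⟨x, hx⟩) Φ]
    exact hsol x hx
  have hFc : ∀ y, ∑ i, partialE3 F y i ^ 2 ≤ (1 - c) ^ 2 := fun y ↦
    (sum_sq_partialE3_le F y).trans (pow_le_pow_left₀ (norm_nonneg _) (hslope y) 2)
  -- ### notation
  set ρ : ℝ := √(R₂ ^ 2 + a ^ 2) with hρ
  set χ : E4 → ℝ := collarCutoff a R₁ R₂ with hχ
  set V : E4 → ℝ := fun x ↦ ∑ μ, |fderiv ℝ χ x (E4.basisVector μ)| with hV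
  set p2 : E4 → ℝ := fun x ↦ ∑ μ, fderiv ℝ Φ x (E4.basisVector μ) ^ 2 with hp2
  set fd : ℝ → E3 → ℝ≥0∞ := fun t y ↦
    ENNReal.ofReal (∑ μ, fderiv ℝ Φ (E4.ofTimeSpace (t + F y) y) (E4.basisVector μ) ^ 2) with hfd
  set T : ℝ → ℝ → Set E3 := fun R t ↦ {y | rPlus M a < radius a (E4.ofTimeSpace (t + F y) y) ∧
    radius a (E4.ofTimeSpace (t + F y) y) ≤ R} with hT
  set Sh : ℝ → Set E3 := fun t ↦ {y | R₁ ≤ radius a (E4.ofTimeSpace (t + F y) y) ∧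
    radius a (E4.ofTimeSpace (t + F y) y) ≤ R₂} with hSh
  set S : ℕ → ℝ → Set E3 := fun n t ↦
    {y | 2 * (1 / ((n : ℝ) + 1)) ≤ horizonFn M a (E4.ofTimeSpace (t + F y) y) ∧
      radius a (E4.ofTimeSpace (t + F y) y) ≤ R₁} with hS
  set E0 : ℝ≥0∞ := ∫⁻ y, (T R₂ 0).indicator (fd 0) y with hE0
  set ShI : ℝ≥0∞ := ∫⁻ u in Set.Ioc 0 s, ∫⁻ y, (Sh u).indicator (fd u) y with hShI
  suffices hfinal : (∫⁻ y, (T R₁ s).indicator (fd s) y) +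
      ∫⁻ u in Set.Ioc 0 s, ∫⁻ y, (T R₁ u).indicator (fd u) y ≤ ENNReal.ofReal (C₆ / c) * (E0 + ShI) by
    exact hfinal.trans (mul_le_mul_left
      (ENNReal.ofReal_le_ofReal (div_le_div_of_nonneg_right hC₆le hc.le)) _)
  have hmemS : ∀ n t y, y ∈ S n t ↔
      2 * (1 / ((n : ℝ) + 1)) ≤ horizonFn M a (E4.ofTimeSpace (t + F y) y) ∧
        radius a (E4.ofTimeSpace (t + F y) y) ≤ R₁ := fun _ _ _ ↦ Iff.rfl
  have hmemT : ∀ R t y, y ∈ T R t ↔ rPlus M a < radius a (E4.ofTimeSpace (t + F y) y) ∧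
      radius a (E4.ofTimeSpace (t + F y) y) ≤ R := fun _ _ _ ↦ Iff.rfl
  have hmemSh : ∀ t y, y ∈ Sh t ↔ R₁ ≤ radius a (E4.ofTimeSpace (t + F y) y) ∧
      radius a (E4.ofTimeSpace (t + F y) y) ≤ R₂ := fun _ _ ↦ Iff.rfl
  -- ### continuity and measurability
  have hp2nn : ∀ x, 0 ≤ p2 x := fun x ↦ Finset.sum_nonneg fun μ _ ↦ sq_nonneg _
  have hV0 : ∀ x, 0 ≤ V x := fun x ↦ Finset.sum_nonneg fun μ _ ↦ abs_nonneg _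
  have hVle : ∀ x, V x ≤ 4 * L := fun x ↦ by
    calc V x = ∑ μ, |fderiv ℝ χ x (E4.basisVector μ)| := rfl
      _ ≤ ∑ _μ : Fin 4, L := Finset.sum_le_sum fun μ _ ↦ (hL x μ).1
      _ = 4 * L := by
          simp only [Finset.sum_const, Finset.card_univ, Fintype.card_fin, nsmul_eq_mul,
            Nat.cast_ofNat]
  have hgraph : ∀ t : ℝ, Continuous fun y : E3 ↦ E4.ofTimeSpace (t + F y) y := fun t ↦
    E4.continuous_ofTimeSpace' (continuous_const.add hF.continuous) continuous_id
  have hgraph2 : Continuous fun p : ℝ × E3 ↦ E4.ofTimeSpace (p.1 + F p.2) p.2 :=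
    E4.continuous_ofTimeSpace' (continuous_fst.add (hF.continuous.comp continuous_snd))
      continuous_snd
  have hfm : ∀ t, Measurable (fd t) := fun t ↦ measurable_sum_sq_fderiv_graph Φ hF.continuous t
  have hf2m : Measurable fun p : ℝ × E3 ↦
      ENNReal.ofReal (∑ μ, fderiv ℝ Φ (E4.ofTimeSpace (p.1 + F p.2) p.2) (E4.basisVector μ) ^ 2) := by
    refine ENNReal.measurable_ofReal.comp (Finset.measurable_sum _ fun μ _ ↦ ?_)
    exact ((measurable_fderiv_apply_const ℝ Φ (E4.basisVector μ)).comp hgraph2.measurable).pow_const 2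
  have hhc : Continuous (horizonFn M a) := continuous_horizonFn M a
  have hSm : ∀ n t, MeasurableSet (S n t) := fun n t ↦ by
    have h1 : IsClosed {y : E3 | 2 * (1 / ((n : ℝ) + 1)) ≤
        horizonFn M a (E4.ofTimeSpace (t + F y) y)} :=
      isClosed_le continuous_const (hhc.comp (hgraph t))
    have h2 : IsClosed {y : E3 | radius a (E4.ofTimeSpace (t + F y) y) ≤ R₁} :=
      isClosed_le ((continuous_radius a).comp (hgraph t)) continuous_const
    have h3 : S n t = {y : E3 | 2 * (1 / ((n : ℝ) + 1)) ≤
        horizonFn M a (E4.ofTimeSpace (t + F y) y)} ∩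
        {y : E3 | radius a (E4.ofTimeSpace (t + F y) y) ≤ R₁} := by
      ext y; simp only [hmemS, Set.mem_inter_iff, Set.mem_setOf_eq]
    rw [h3]
    exact (h1.inter h2).measurableSet
  have hS2c : ∀ n : ℕ, IsClosed ({p : ℝ × E3 | 2 * (1 / ((n : ℝ) + 1)) ≤
      horizonFn M a (E4.ofTimeSpace (p.1 + F p.2) p.2)} ∩
      {p : ℝ × E3 | radius a (E4.ofTimeSpace (p.1 + F p.2) p.2) ≤ R₁}) := fun n ↦
    (isClosed_le continuous_const (hhc.comp hgraph2)).inter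
      (isClosed_le ((continuous_radius a).comp hgraph2) continuous_const)
  have hGm : ∀ n, Measurable fun u ↦ ∫⁻ y, (S n u).indicator (fd u) y := by
    intro n
    have hm := (hf2m.indicator (hS2c n).measurableSet).lintegral_prod_right' (ν := volume)
    have heq : (fun u ↦ ∫⁻ y, (S n u).indicator (fd u) y) = fun u : ℝ ↦ ∫⁻ y : E3,
        ({p : ℝ × E3 | 2 * (1 / ((n : ℝ) + 1)) ≤
            horizonFn M a (E4.ofTimeSpace (p.1 + F p.2) p.2)} ∩
          {p : ℝ × E3 | radius a (E4.ofTimeSpace (p.1 + F p.2) p.2) ≤ R₁}).indicator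
          (fun p : ℝ × E3 ↦ ENNReal.ofReal
            (∑ μ, fderiv ℝ Φ (E4.ofTimeSpace (p.1 + F p.2) p.2) (E4.basisVector μ) ^ 2))
          (u, y) := by
      funext u
      refine lintegral_congr fun y ↦ ?_
      simp only [Set.indicator_apply, hmemS, Set.mem_inter_iff, Set.mem_setOf_eq, hfd]
    rw [heq]
    exact hm
  -- continuity of the densities on `ℝ⁴`
  have hp2c : ∀ x ∈ (exterior M a : Set E4), ContinuousAt p2 x := by
    intro x hx
    have h2 : ContDiffAt ℝ ((1 : ℕ∞) + 1 : ℕ∞) Φ x := by exact_mod_cast hΦ x hx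
    exact tendsto_finsetSum _ fun ν _ ↦
      (((h2.fderiv_right (m := 1) le_rfl).clm_apply contDiffAt_const).continuousAt).pow 2
  have hχ1 : ContDiff ℝ 1 χ := contDiff_collarCutoff hR₁pos hR12
  set Ksh : Set E4 := {x | R₁ ≤ radius a x ∧ radius a x ≤ R₂} with hKsh
  have hKshc : IsClosed Ksh := by
    rw [hKsh, Set.setOf_and]
    exact (isClosed_le continuous_const (continuous_radius a)).inter
      (isClosed_le (continuous_radius a) continuous_const)
  have hKshU : Ksh ⊆ (exterior M a : Set E4) := fun x hx ↦
    mem_exterior.2 (max_lt (hrR₁.trans_le hx.1) (hrp.trans (hrR₁.trans_le hx.1)))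
  have hVc : Continuous V :=
    continuous_finsetSum _ fun μ _ ↦
      ((hχ1.continuous_fderiv one_ne_zero).clm_apply continuous_const).abs
  have hVz : ∀ x, x ∉ Ksh → V x = 0 := by
    intro x hx
    refine Finset.sum_eq_zero fun μ _ ↦ ?_
    by_contra hne
    exact hx ((hL x μ).2 (fun h0 ↦ hne (by rw [h0, abs_zero])))
  have hVp2c : Continuous fun x ↦ V x * p2 x :=
    continuous_iff_continuousAt.mpr fun x ↦ continuousAt_weight_mul hKshc hKshU hVc hVz hp2c x
  set Zt : ℝ → ℝ := fun t ↦ ∫ y in closedBall (0 : E3) ρ,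
    V (E4.ofTimeSpace (t + F y) y) * p2 (E4.ofTimeSpace (t + F y) y) with hZt
  have hZc : Continuous Zt :=
    continuous_parametric_integral_of_continuous
      (f := fun (t : ℝ) (y : E3) ↦ V (E4.ofTimeSpace (t + F y) y) * p2 (E4.ofTimeSpace (t + F y) y))
      (hVp2c.comp hgraph2) (isCompact_closedBall _ _)
  have hZnn : ∀ t, 0 ≤ Zt t := fun t ↦
    setIntegral_nonneg measurableSet_closedBall fun y _ ↦ mul_nonneg (hV0 _) (hp2nn _)
  have hZi : ∀ t, IntegrableOn
      (fun y : E3 ↦ V (E4.ofTimeSpace (t + F y) y) * p2 (E4.ofTimeSpace (t + F y) y))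
      (closedBall (0 : E3) ρ) := fun t ↦
    (hVp2c.comp (hgraph t)).continuousOn.integrableOn_compact (isCompact_closedBall _ _)
  set Z : ℝ := ∫ u in Set.Ioc 0 s, Zt u with hZ
  have hZnn' : 0 ≤ Z := setIntegral_nonneg measurableSet_Ioc fun u _ ↦ hZnn u
  -- the error term: `Z ≤ 4L · ShI`
  have herr : ENNReal.ofReal Z ≤ ENNReal.ofReal (4 * L) * ShI := by
    have h1 : ∀ u, ENNReal.ofReal (Zt u) ≤
        ENNReal.ofReal (4 * L) * ∫⁻ y, (Sh u).indicator (fd u) y := by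
      intro u
      rw [show Zt u = ∫ y in closedBall (0 : E3) ρ,
          V (E4.ofTimeSpace (u + F y) y) * p2 (E4.ofTimeSpace (u + F y) y) from rfl,
        ofReal_integral_eq_lintegral_ofReal (hZi u)
          (ae_of_all _ fun y ↦ mul_nonneg (hV0 _) (hp2nn _)),
        ← lintegral_const_mul' _ _ ENNReal.ofReal_ne_top]
      calc ∫⁻ y in closedBall (0 : E3) ρ,
            ENNReal.ofReal (V (E4.ofTimeSpace (u + F y) y) * p2 (E4.ofTimeSpace (u + F y) y))
          ≤ ∫⁻ y in closedBall (0 : E3) ρ, ENNReal.ofReal (4 * L) * (Sh u).indicator (fd u) y := by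
            refine lintegral_mono fun y ↦ ?_
            by_cases hy : E4.ofTimeSpace (u + F y) y ∈ Ksh
            · have hyS : y ∈ Sh u := hy
              rw [Set.indicator_of_mem hyS, ← ENNReal.ofReal_mul (by positivity)]
              exact ENNReal.ofReal_le_ofReal (mul_le_mul_of_nonneg_right (hVle _) (hp2nn _))
            · rw [hVz _ hy, zero_mul, ENNReal.ofReal_zero]
              exact zero_le
        _ ≤ ∫⁻ y, ENNReal.ofReal (4 * L) * (Sh u).indicator (fd u) y :=
            setLIntegral_le_lintegral _ _
    calc ENNReal.ofReal Z = ∫⁻ u in Set.Ioc 0 s, ENNReal.ofReal (Zt u) :=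
          ofReal_integral_eq_lintegral_ofReal
            (hZc.integrableOn_Icc.mono_set Set.Ioc_subset_Icc_self) (ae_of_all _ fun u ↦ hZnn u)
      _ ≤ ∫⁻ u in Set.Ioc 0 s, ENNReal.ofReal (4 * L) * ∫⁻ y, (Sh u).indicator (fd u) y :=
          lintegral_mono fun u ↦ h1 u
      _ = ENNReal.ofReal (4 * L) * ShI := by
          rw [hShI, lintegral_const_mul' _ _ ENNReal.ofReal_ne_top]
  -- ### Step 1: the estimate at receding parameter `ε = 1/(n+1)`
  have hstep : ∀ n : ℕ, (∫⁻ y, (S n s).indicator (fd s) y) +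
      ∫⁻ u in Set.Ioc 0 s, ∫⁻ y, (S n u).indicator (fd u) y ≤
        ENNReal.ofReal (C₆ / c) * (E0 + ShI) := by
    intro n
    set ε : ℝ := 1 / ((n : ℝ) + 1) with hεdef
    have hε : 0 < ε := by positivity
    set W : E4 → ℝ := redShiftWeight M a R₁ R₂ ε with hW
    set K : Set E4 := redShiftWeightSet M a R₂ ε with hK
    have hKc : IsClosed K := isClosed_redShiftWeightSet M a R₂ ε
    have hKU : K ⊆ (exterior M a : Set E4) := redShiftWeightSet_subset_exterior hrp hε
    have hWK : ∀ x, W x ≠ 0 → x ∈ K := fun x hx ↦ mem_redShiftWeightSet_of_ne_zero hR12 hε hx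
    have hWz : ∀ x, x ∉ K → W x = 0 := fun x hx ↦ by
      by_contra h
      exact hx (hWK x h)
    have hW1 : ContDiff ℝ 1 W := contDiff_redShiftWeight hR₁pos hR12 hrp hε
    have hW0 : ∀ x, 0 ≤ W x := redShiftWeight_nonneg M a R₁ R₂ ε
    have hWle : ∀ x, W x ≤ 1 := redShiftWeight_le_one M a R₁ R₂ ε
    have hWp2c : Continuous fun x ↦ W x * p2 x :=
      continuous_iff_continuousAt.mpr fun x ↦
        continuousAt_weight_mul hKc hKU hW1.continuous hWz hp2c x
    -- the real slice integrals of the weighted density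
    set Xt : ℝ → ℝ := fun t ↦ ∫ y in closedBall (0 : E3) ρ,
      W (E4.ofTimeSpace (t + F y) y) * p2 (E4.ofTimeSpace (t + F y) y) with hXt
    have hXc : Continuous Xt :=
      continuous_parametric_integral_of_continuous
        (f := fun (t : ℝ) (y : E3) ↦ W (E4.ofTimeSpace (t + F y) y) * p2 (E4.ofTimeSpace (t + F y) y))
        (hWp2c.comp hgraph2) (isCompact_closedBall _ _)
    have hXnn : ∀ t, 0 ≤ Xt t := fun t ↦
      setIntegral_nonneg measurableSet_closedBall fun y _ ↦ mul_nonneg (hW0 _) (hp2nn _)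
    have hXi : ∀ t, IntegrableOn
        (fun y : E3 ↦ W (E4.ofTimeSpace (t + F y) y) * p2 (E4.ofTimeSpace (t + F y) y))
        (closedBall (0 : E3) ρ) := fun t ↦
      (hWp2c.comp (hgraph t)).continuousOn.integrableOn_compact (isCompact_closedBall _ _)
    set Y : ℝ := ∫ u in Set.Ioc 0 s, Xt u with hY
    have hYnn : 0 ≤ Y := setIntegral_nonneg measurableSet_Ioc fun u _ ↦ hXnn u
    -- the weighted estimate of Part 5
    have hw : A * c * Xt s + A * Y ≤ C * Xt 0 + C * Z := by
      have h := hest F c hF hc hc1 hFc Φ hΦ hsolB ε hε s hs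
      simpa only [hXt, hY, hZ, hZt, hW, hV, hp2, hχ] using h
    -- the real inequality `Xt s + Y ≤ (C + 1)/(A c) · (Xt 0 + Z)`
    have hkey : Xt s + Y ≤ (C + 1) / (A * c) * (Xt 0 + Z) := by
      have hX0 := hXnn 0
      have hXs := hXnn s
      have h1 : A * c * Y ≤ A * Y := by
        have : A * c ≤ A := by nlinarith only [hA, hc1]
        exact mul_le_mul_of_nonneg_right this hYnn
      have h2 : C * Xt 0 + C * Z ≤ (C + 1) * (Xt 0 + Z) := by nlinarith only [hX0, hZnn']
      rw [div_mul_eq_mul_div, le_div_iff₀ (mul_pos hA hc)]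
      nlinarith only [h1, h2, hw]
    -- (a) the leaf integrals from below: `W = 1` on `S n t ⊆ {‖y‖ ≤ ρ}`
    have hSK : ∀ t y, y ∈ S n t → E4.ofTimeSpace (t + F y) y ∈ K := fun t y hy ↦ by
      rw [hmemS] at hy
      refine ⟨?_, hy.2.trans hR12.le⟩
      show ε ≤ horizonFn M a (E4.ofTimeSpace (t + F y) y)
      rw [hεdef]
      linarith [hy.1, hε.le]
    have hSball : ∀ t, S n t ⊆ closedBall (0 : E3) ρ := fun t y hy ↦ by
      rw [mem_closedBall, dist_zero_right]
      have h := spatialNorm_le_of_mem_redShiftWeightSet hrp hε (hSK t y hy)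
      rwa [E4.spatialNorm_ofTimeSpace] at h
    have hW1S : ∀ t y, y ∈ S n t → W (E4.ofTimeSpace (t + F y) y) = 1 := fun t y hy ↦ by
      rw [hmemS] at hy
      refine redShiftWeight_eq_one hR12 hε ?_ hy.2
      rw [hεdef]
      exact hy.1
    have hleaf : ∀ t, ∫⁻ y, (S n t).indicator (fd t) y ≤ ENNReal.ofReal (Xt t) := by
      intro t
      rw [lintegral_indicator (hSm n t)]
      calc ∫⁻ y in S n t, fd t y
          ≤ ∫⁻ y in S n t, ENNReal.ofReal
              (W (E4.ofTimeSpace (t + F y) y) * p2 (E4.ofTimeSpace (t + F y) y)) :=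
            setLIntegral_mono' (hSm n t) fun y hy ↦ by
              rw [hW1S t y hy, one_mul]
        _ ≤ ∫⁻ y in closedBall (0 : E3) ρ, ENNReal.ofReal
              (W (E4.ofTimeSpace (t + F y) y) * p2 (E4.ofTimeSpace (t + F y) y)) :=
            lintegral_mono_set (hSball t)
        _ = ENNReal.ofReal (Xt t) :=
            (ofReal_integral_eq_lintegral_ofReal (hXi t)
              (ae_of_all _ fun y ↦ mul_nonneg (hW0 _) (hp2nn _))).symm
    -- (b) the bulk from below
    have hbulk : ∫⁻ u in Set.Ioc 0 s, ∫⁻ y, (S n u).indicator (fd u) y ≤ ENNReal.ofReal Y := by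
      calc ∫⁻ u in Set.Ioc 0 s, ∫⁻ y, (S n u).indicator (fd u) y
          ≤ ∫⁻ u in Set.Ioc 0 s, ENNReal.ofReal (Xt u) := lintegral_mono fun u ↦ hleaf u
        _ = ENNReal.ofReal Y :=
            (ofReal_integral_eq_lintegral_ofReal
              (hXc.integrableOn_Icc.mono_set Set.Ioc_subset_Icc_self)
              (ae_of_all _ fun u ↦ hXnn u)).symm
    -- (c) the initial leaf integral from above: `W ≤ 1_{r₊ < r ≤ R₂}`
    have hinit : ENNReal.ofReal (Xt 0) ≤ E0 := by
      rw [show Xt 0 = ∫ y in closedBall (0 : E3) ρ,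
          W (E4.ofTimeSpace (0 + F y) y) * p2 (E4.ofTimeSpace (0 + F y) y) from rfl,
        ofReal_integral_eq_lintegral_ofReal (hXi 0)
          (ae_of_all _ fun y ↦ mul_nonneg (hW0 _) (hp2nn _))]
      calc ∫⁻ y in closedBall (0 : E3) ρ,
            ENNReal.ofReal (W (E4.ofTimeSpace (0 + F y) y) * p2 (E4.ofTimeSpace (0 + F y) y))
          ≤ ∫⁻ y in closedBall (0 : E3) ρ, (T R₂ 0).indicator (fd 0) y := by
            refine lintegral_mono fun y ↦ ?_
            by_cases hWy : W (E4.ofTimeSpace (0 + F y) y) = 0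
            · rw [hWy, zero_mul, ENNReal.ofReal_zero]
              exact zero_le
            · have hmem : E4.ofTimeSpace (0 + F y) y ∈ K := hWK _ hWy
              have hyT : y ∈ T R₂ 0 :=
                (hmemT R₂ 0 y).2 ⟨rPlus_lt_radius_of_mem_redShiftWeightSet hε hmem, hmem.2⟩
              rw [Set.indicator_of_mem hyT]
              refine ENNReal.ofReal_le_ofReal ?_
              calc W (E4.ofTimeSpace (0 + F y) y) * p2 (E4.ofTimeSpace (0 + F y) y)
                  ≤ 1 * p2 (E4.ofTimeSpace (0 + F y) y) :=
                    mul_le_mul_of_nonneg_right (hWle _) (hp2nn _)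
                _ = p2 (E4.ofTimeSpace (0 + F y) y) := one_mul _
        _ ≤ E0 := setLIntegral_le_lintegral _ _
    -- (d) assemble in `[0, ∞]`
    have hq0 : 0 < (C + 1) / (A * c) := div_pos hC1 (mul_pos hA hc)
    have hqC₆ : (C + 1) / (A * c) * (1 + 4 * L) = C₆ / c := by
      rw [hC₆]
      field_simp
    have hq4 : 0 ≤ (C + 1) / (A * c) * (4 * L) := mul_nonneg hq0.le (by positivity)
    have hqexp : (C + 1) / (A * c) * (1 + 4 * L) =
        (C + 1) / (A * c) + (C + 1) / (A * c) * (4 * L) := by ring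
    have hr1 : (C + 1) / (A * c) ≤ C₆ / c := by
      rw [← hqC₆, hqexp]
      linarith only [hq4]
    have hr2 : (C + 1) / (A * c) * (4 * L) ≤ C₆ / c := by
      rw [← hqC₆, hqexp]
      linarith only [hq0]
    calc (∫⁻ y, (S n s).indicator (fd s) y) + ∫⁻ u in Set.Ioc 0 s, ∫⁻ y, (S n u).indicator (fd u) y
        ≤ ENNReal.ofReal (Xt s) + ENNReal.ofReal Y := add_le_add (hleaf s) hbulk
      _ = ENNReal.ofReal (Xt s + Y) := (ENNReal.ofReal_add (hXnn s) hYnn).symm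
      _ ≤ ENNReal.ofReal ((C + 1) / (A * c) * (Xt 0 + Z)) := ENNReal.ofReal_le_ofReal hkey
      _ = ENNReal.ofReal ((C + 1) / (A * c)) * (ENNReal.ofReal (Xt 0) + ENNReal.ofReal Z) := by
          rw [ENNReal.ofReal_mul hq0.le, ENNReal.ofReal_add (hXnn 0) hZnn']
      _ ≤ ENNReal.ofReal ((C + 1) / (A * c)) * (E0 + ENNReal.ofReal (4 * L) * ShI) := by
          gcongr
      _ = ENNReal.ofReal ((C + 1) / (A * c)) * E0 +
            ENNReal.ofReal ((C + 1) / (A * c) * (4 * L)) * ShI := by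
          rw [mul_add, ENNReal.ofReal_mul hq0.le, mul_assoc]
      _ ≤ ENNReal.ofReal (C₆ / c) * E0 + ENNReal.ofReal (C₆ / c) * ShI := by
          gcongr
      _ = ENNReal.ofReal (C₆ / c) * (E0 + ShI) := (mul_add _ _ _).symm
  -- ### Step 2: exhaustion `n → ∞`
  have hSmono : ∀ t, Monotone fun n ↦ S n t := by
    intro t n m hnm y hy
    rw [hmemS] at hy ⊢
    have hcast : (n : ℝ) ≤ m := Nat.cast_le.mpr hnm
    refine ⟨le_trans ?_ hy.1, hy.2⟩
    have h1 : (0 : ℝ) < (n : ℝ) + 1 := by positivity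
    gcongr
  have hUnion : ∀ t, T R₁ t = ⋃ n, S n t := by
    intro t
    ext y
    rw [Set.mem_iUnion, hmemT]
    constructor
    · rintro ⟨hr, hR⟩
      set h : ℝ := horizonFn M a (E4.ofTimeSpace (t + F y) y) with hh
      have hpos : 0 < h := mul_pos (sub_pos.mpr hr) (Real.exp_pos _)
      obtain ⟨n, hn⟩ := exists_nat_ge (2 / h)
      refine ⟨n, (hmemS n t y).2 ⟨?_, hR⟩⟩
      have hn1 : (0 : ℝ) < (n : ℝ) + 1 := by positivity
      rw [div_le_iff₀ hpos] at hn
      rw [← hh, mul_one_div, div_le_iff₀ hn1]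
      have hmul : h * ((n : ℝ) + 1) = (n : ℝ) * h + h := by ring
      rw [hmul]
      linarith only [hn, hpos]
    · rintro ⟨n, hn⟩
      rw [hmemS] at hn
      have hpos : 0 < horizonFn M a (E4.ofTimeSpace (t + F y) y) :=
        lt_of_lt_of_le (by positivity) hn.1
      exact ⟨rPlus_lt_radius_of_horizonFn_pos hpos, hn.2⟩
  have hind : ∀ t y, (T R₁ t).indicator (fd t) y = ⨆ n, (S n t).indicator (fd t) y := fun t y ↦ by
    rw [hUnion t]
    exact Set.indicator_iUnion_apply rfl _ _ _
  have hmonof : ∀ t, Monotone fun n ↦ (S n t).indicator (fd t) := fun t n m hnm y ↦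
    Set.indicator_le_indicator_of_subset (hSmono t hnm) (fun _ ↦ zero_le) y
  have hleafsup : ∀ t, ∫⁻ y, (T R₁ t).indicator (fd t) y =
      ⨆ n, ∫⁻ y, (S n t).indicator (fd t) y := by
    intro t
    calc ∫⁻ y, (T R₁ t).indicator (fd t) y = ∫⁻ y, ⨆ n, (S n t).indicator (fd t) y :=
          lintegral_congr (hind t)
      _ = ⨆ n, ∫⁻ y, (S n t).indicator (fd t) y :=
          lintegral_iSup (fun n ↦ (hfm t).indicator (hSm n t)) (hmonof t)
  have hbulksup : ∫⁻ u in Set.Ioc 0 s, ∫⁻ y, (T R₁ u).indicator (fd u) y =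
      ⨆ n, ∫⁻ u in Set.Ioc 0 s, ∫⁻ y, (S n u).indicator (fd u) y := by
    calc ∫⁻ u in Set.Ioc 0 s, ∫⁻ y, (T R₁ u).indicator (fd u) y
        = ∫⁻ u in Set.Ioc 0 s, ⨆ n, ∫⁻ y, (S n u).indicator (fd u) y :=
          lintegral_congr fun u ↦ hleafsup u
      _ = ⨆ n, ∫⁻ u in Set.Ioc 0 s, ∫⁻ y, (S n u).indicator (fd u) y :=
          lintegral_iSup (fun n ↦ hGm n)
            (fun n m hnm u ↦ lintegral_mono fun y ↦ hmonof u hnm y)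
  rw [hleafsup s, hbulksup, ENNReal.iSup_add_iSup_of_monotone]
  · exact iSup_le hstep
  · exact fun n m hnm ↦ lintegral_mono fun y ↦ hmonof s hnm y
  · exact fun n m hnm ↦ lintegral_mono fun u ↦ lintegral_mono fun y ↦ hmonof u hnm y

/-- **The κ-explicit red-shift estimate in the format of the near-extremal integrated-decay programme**
(crux `KappaExplicitWaveDecay`, S6a′, `RedShiftPoly` CORRECTED: the constant carries `(κη)⁻¹`, not `κ⁻¹`
alone — an `η`-uniform constant is impossible, see the module docstring). For every `M > 0` there are
`a₁ < M`, `C₀ > 0`, `q` (here `a₁ = 0`, `q = 1`) such that for all `a₁ ≤ |a| < M` and all collar widths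
`0 < η ≤ κ/C₀` (LINEAR in `κ = Kerr.surfaceGravity M a`), the red-shift estimate between admissible graph
leaves holds with constant `C₀(κη)^{-q}/c`. From `Kerr.redShift_estimate_poly` with
`C₀ = max(4096/M², 1201(6/(4M) + P)(M/16384 + 16C_σ))`, `P = 48000(160D + 1) + 8000`, using `κ ≤ 1/(4M)`,
`η ≤ M/16384`. [cite: DafermosRodnianskiShlapentokhrothman2014, Prop. 4.5.2] -/
theorem redShiftPoly_kappaEta :
    ∀ M : ℝ, 0 < M → ∃ (a₁ C₀ : ℝ) (q : ℕ), a₁ < M ∧ 0 < C₀ ∧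
    ∀ a : ℝ, a₁ ≤ |a| → IsSubextremal M a →
    ∀ η : ℝ, 0 < η → η ≤ surfaceGravity M a / C₀ →
      ∀ (F : E3 → ℝ) (c : ℝ), ContDiff ℝ 2 F → 0 < c → c ≤ 1 →
      (∀ y, ‖fderiv ℝ F y‖ ≤ 1 - c) →
      ∀ Φ : E4 → ℝ,
      (∀ x ∈ (exterior M a : Set E4), ContDiffAt ℝ 2 Φ x) →
      (∀ x ∈ (exterior M a : Set E4),
        KerrSchild.waveOperator
          (KerrSchild.inverseMetric (fun y ↦ 2 * scalarH M a y) (nullVector a)) Φ x = 0) →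
      ∀ s : ℝ, 0 ≤ s →
        (∫⁻ y, {y : E3 | rPlus M a < radius a (E4.ofTimeSpace (s + F y) y) ∧
              radius a (E4.ofTimeSpace (s + F y) y) ≤ rPlus M a + η / 2}.indicator
            (fun y ↦ ENNReal.ofReal
              (∑ μ, fderiv ℝ Φ (E4.ofTimeSpace (s + F y) y) (E4.basisVector μ) ^ 2)) y) +
          ∫⁻ u in Set.Ioc 0 s, ∫⁻ y,
            {y : E3 | rPlus M a < radius a (E4.ofTimeSpace (u + F y) y) ∧
              radius a (E4.ofTimeSpace (u + F y) y) ≤ rPlus M a + η / 2}.indicator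
            (fun y ↦ ENNReal.ofReal
              (∑ μ, fderiv ℝ Φ (E4.ofTimeSpace (u + F y) y) (E4.basisVector μ) ^ 2)) y ≤
        ENNReal.ofReal (C₀ * (surfaceGravity M a * η)⁻¹ ^ q / c) *
          ((∫⁻ y, {y : E3 | rPlus M a < radius a (E4.ofTimeSpace (0 + F y) y) ∧
                radius a (E4.ofTimeSpace (0 + F y) y) ≤ rPlus M a + η}.indicator
              (fun y ↦ ENNReal.ofReal
                (∑ μ, fderiv ℝ Φ (E4.ofTimeSpace (0 + F y) y) (E4.basisVector μ) ^ 2)) y) +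
            ∫⁻ u in Set.Ioc 0 s, ∫⁻ y,
              {y : E3 | rPlus M a + η / 2 ≤ radius a (E4.ofTimeSpace (u + F y) y) ∧
                radius a (E4.ofTimeSpace (u + F y) y) ≤ rPlus M a + η}.indicator
              (fun y ↦ ENNReal.ofReal
                (∑ μ, fderiv ℝ Φ (E4.ofTimeSpace (u + F y) y) (E4.basisVector μ) ^ 2)) y) := by
  intro M hM
  obtain ⟨Cσ, hC0σ, hCσ⟩ := exists_bound_deriv_smoothTransition
  set P : ℝ := 48000 * (160 * ((4640 + 80 * Cσ) / M) + 1) + 8000 with hP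
  have hP0 : 0 < P := by positivity
  set C₀ : ℝ := max (4096 / M ^ 2) (1201 * (6 / (4 * M) + P) * (M / 16384 + 16 * Cσ)) with hC₀
  have hC₀pos : 0 < C₀ := lt_max_of_lt_left (by positivity)
  refine ⟨0, C₀, 1, hM, hC₀pos, ?_⟩
  intro a _ hMa η hη hηC F c hF hc hc1 hslope Φ hΦ hsol s hs
  have hκ : 0 < surfaceGravity M a := hMa.surfaceGravity_pos
  have hκle : surfaceGravity M a ≤ 1 / (4 * M) := surfaceGravity_le hM a
  -- `η ≤ κ/C₀ ≤ M²κ/4096`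
  have hηle : η ≤ M ^ 2 * surfaceGravity M a / 4096 := by
    refine hηC.trans ?_
    rw [div_le_div_iff₀ hC₀pos (by norm_num)]
    have h1 : 4096 / M ^ 2 ≤ C₀ := le_max_left _ _
    have h2 : surfaceGravity M a * 4096 = 4096 / M ^ 2 * (M ^ 2 * surfaceGravity M a) := by
      field_simp
    rw [h2, mul_comm (M ^ 2 * surfaceGravity M a) C₀]
    exact mul_le_mul_of_nonneg_right h1 (by positivity)
  have hηM : η ≤ M / 16384 := by
    refine hηle.trans ?_
    rw [div_le_div_iff₀ (by norm_num) (by norm_num)]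
    have hMκ : M * surfaceGravity M a ≤ 1 / 4 := by
      rw [le_div_iff₀ (by positivity : (0 : ℝ) < 4 * M)] at hκle; linarith
    nlinarith
  have hest := redShift_estimate_poly hMa hCσ hη hηle F c hF hc hc1 hslope Φ hΦ hsol s hs
  refine hest.trans (mul_le_mul_left (ENNReal.ofReal_le_ofReal
    (div_le_div_of_nonneg_right ?_ hc.le)) _)
  -- the explicit constant is `≤ C₀ (κη)⁻¹`
  rw [pow_one, ← hP]
  have hkey : 1201 * (6 + P / surfaceGravity M a) * (1 + 16 * Cσ / η) =
      1201 * (6 * surfaceGravity M a + P) * (η + 16 * Cσ) * (surfaceGravity M a * η)⁻¹ := by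
    field_simp
  rw [hkey]
  refine mul_le_mul_of_nonneg_right ?_ (by positivity)
  calc 1201 * (6 * surfaceGravity M a + P) * (η + 16 * Cσ)
      ≤ 1201 * (6 / (4 * M) + P) * (M / 16384 + 16 * Cσ) := by
        have h6 : 6 * surfaceGravity M a ≤ 6 / (4 * M) := by
          rw [show 6 / (4 * M) = 6 * (1 / (4 * M)) by ring]; linarith
        gcongr
    _ ≤ C₀ := le_max_right _ _

end Kerr

end Literature.Geometry.Lorentzian

end
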